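import Summits.Ventures.PercRepro.RankLevelSetHallForm

/-!
# PercRepro — C-044 LEVEL BY LEVEL: the rank-level LYM form of the Hall conditions (night-1, gen 23)

THE LEVEL-WISE FORM. For a finite matroid `M`, a cell `q + 2 ≤ p`, a subfamily `𝒜` of the members `𝒵(p,q)`
(`r(Z) = q`, `r(E ∖ Z) = p`) and a LEVEL `q < t < p`, count the neighbours of RANK `t` only:
`C(p+q, t)·#𝒜 ≤ C(p+q, q)·#{S ∈ N(𝒜) : r(S) = t}`.  Summed over the levels `q < t < p` this is exactly the Φ-matching
(Hall) form of C-044 (`Φ(p,q) = Σ_t C(p+q,t)/C(p+q,p)`, and `C(p+q,p) = C(p+q,q)`); on the free matroid it is the Boolean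
LOCAL LYM inequality (equality for `𝒜 = 𝒵`).  It is NOT a pointwise rule: the equal split (Rule Q) fails level by
level on the deficit slices; the certificate is a flow.

* `LevelHallUpC025` (a `Prop`, NOT asserted) — the UP form level by level; census (night-1 g23, own exact max-flow):
  every matroid on ≤ 8 elements, every cell, every level (5,658 cells at n = 8), every matroid on 9 elements at the tight
  layer (1,290), the model family `T_{q+k}(U_{q,F} ⊕ free)` by the exact type flow at Rule Q's failing cells and on
  sweeps (q ≤ 30, k ≤ 9, 17,820 instances), truncated direct sums of two / three uniform matroids (55,119 instances):
  0 violations;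
* **`hallUp_of_levelHallUp`**, **`c025_of_levelHallUp`** — the level-wise UP form implies C-044 UP and hence C-025;
* **`hallDown_level_of_ncard_eq`** — the DOWN form level by level is a THEOREM at the tight layer `|E| = p + q`:
  the rank-`t` DOWN-neighbours are the `t`-subsets of the bases `E ∖ Z`, and the Boolean shadow bound of
  `RankLevelSetHallTight` gives `C(p+q,t)·#𝒜 ≤ C(p+q,q)·#{S ∈ N_down(𝒜) : r(S) = t}` at every level.
Axioms: standard.
-/

namespace PercRepro

open Set Matroid Finset

variable {α : Type} {M : Matroid α} [M.Finite]

omit [M.Finite] in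
/-- **THE LEVEL-WISE (RANK-LEVEL) LYM FORM OF C-044, UP** (night-1 g23; a `Prop`, NOT asserted): for every finite
matroid, every cell `q + 2 ≤ p`, every subfamily `𝒜` of members and every level `q < t < p`,
`C(p+q,t)·#𝒜 ≤ C(p+q,q)·#{S ∈ upNbhd 𝒜 : r(S) = t}`. -/
def LevelHallUpC025 : Prop :=
  ∀ {α : Type} (M : Matroid α) [M.Finite] (p q t : ℕ), q + 2 ≤ p → q < t → t < p →
    ∀ 𝒜 ⊆ cellMembers M p q,
      ((p + q).choose t : ℚ) * (𝒜.ncard : ℚ) ≤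
        ((p + q).choose q : ℚ) * ({S ∈ upNbhd M p q 𝒜 | M.eRk S = (t : ℕ∞)}.ncard : ℚ)

/-- A finite family of subsets of `E` with ranks in `(q, p)` splits into its rank levels:
`#𝒩 = Σ_{q<t<p} #{S ∈ 𝒩 : r(S) = t}`. -/
lemma ncard_eq_sum_ncard_level (p q : ℕ) (𝒩 : Set (Set α)) (h𝒩 : 𝒩 ⊆ cellY M p q) :
    (𝒩.ncard : ℚ) = ∑ t ∈ Finset.Ioo q p, ({S ∈ 𝒩 | M.eRk S = (t : ℕ∞)}.ncard : ℚ) := by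
  classical
  have hEfin : M.E.Finite := M.ground_finite
  have hNfin : 𝒩.Finite := hEfin.finite_subsets.subset (fun S hS => (h𝒩 hS).1)
  set N : Finset (Set α) := hNfin.toFinset with hN
  have hmaps : ((N : Set (Set α))).MapsTo (fun S => (M.eRk S).toNat) (Finset.Ioo q p : Finset ℕ) := by
    intro S hS
    rw [Finset.mem_coe, hN, hNfin.mem_toFinset] at hS
    obtain ⟨-, hq, hp⟩ := h𝒩 hS
    have hne : M.eRk S ≠ ⊤ := ne_top_of_lt hp
    rw [Finset.mem_coe, Finset.mem_Ioo]
    constructor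
    · have h' : (q : ℕ∞) < ((M.eRk S).toNat : ℕ∞) := by rwa [ENat.coe_toNat hne]
      exact_mod_cast h'
    · have h' : ((M.eRk S).toNat : ℕ∞) < (p : ℕ∞) := by rwa [ENat.coe_toNat hne]
      exact_mod_cast h'
  have hcard := Finset.card_eq_sum_card_fiberwise hmaps
  have hslice : ∀ t ∈ Finset.Ioo q p,
      {S ∈ 𝒩 | M.eRk S = (t : ℕ∞)}.ncard = (N.filter (fun S => (M.eRk S).toNat = t)).card := by
    intro t _
    rw [← Set.ncard_coe_finset]
    congr 1
    ext S
    simp only [Finset.coe_filter, Set.mem_setOf_eq, hN, hNfin.mem_toFinset]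
    constructor
    · rintro ⟨hS, hr⟩
      exact ⟨hS, by rw [hr]; exact ENat.toNat_coe t⟩
    · rintro ⟨hS, hr⟩
      refine ⟨hS, ?_⟩
      have hne : M.eRk S ≠ ⊤ := ne_top_of_lt (h𝒩 hS).2.2
      rw [← ENat.coe_toNat hne, hr]
  rw [ncard_eq_toFinset_card _ hNfin, ← hN, hcard]
  push_cast
  refine Finset.sum_congr rfl (fun t ht => ?_)
  rw [hslice t ht]

/-- **The level-wise UP form implies the Φ-matching (Hall) UP form of C-044**: sum the level inequalities over
`q < t < p` (`Φ(p,q) = Σ_t C(p+q,t)/C(p+q,p)`, `C(p+q,p) = C(p+q,q)`). -/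
theorem hallUp_of_levelHallUp (h : LevelHallUpC025) : HallUpC025 := by
  intro α M _ p q hpq 𝒜 h𝒜
  classical
  have hsplit := ncard_eq_sum_ncard_level (M := M) p q (upNbhd M p q 𝒜)
    (upNbhd_subset_cellY (M := M) 𝒜 p q)
  have hchoose : (0 : ℚ) < ((p + q).choose p : ℚ) := by
    exact_mod_cast Nat.choose_pos (by omega)
  have hsym : ((p + q).choose q : ℚ) = ((p + q).choose p : ℚ) := by
    exact_mod_cast (Nat.choose_symm_add (a := p) (b := q)).symm
  rw [hsplit]
  unfold phiK
  rw [div_mul_eq_mul_div, div_le_iff₀ hchoose, Finset.sum_mul, Finset.sum_mul]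
  refine Finset.sum_le_sum (fun t ht => ?_)
  rw [Finset.mem_Ioo] at ht
  have := h M p q t hpq ht.1 ht.2 𝒜 h𝒜
  rw [hsym] at this
  linarith

/-- **The level-wise UP form implies C-025** (through C-044 UP, `c025_of_hallUp`). -/
theorem c025_of_levelHallUp (h : LevelHallUpC025) : C025 :=
  c025_of_hallUp (hallUp_of_levelHallUp h)

/-- **THE DOWN FORM LEVEL BY LEVEL IS A THEOREM AT THE TIGHT LAYER** `|E| = p + q`: for every subfamily `𝒜` of members
and every level `q < t < p`, `C(p+q,t)·#𝒜 ≤ C(p+q,q)·#{S ∈ downNbhd 𝒜 : r(S) = t}` — the rank-`t` DOWN-neighbours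
are exactly the `t`-subsets of the bases `E ∖ Z` (`Z ∈ 𝒜`), and the Boolean shadow bound
`choose_mul_card_le_choose_mul_card_shadow` counts them. -/
theorem hallDown_level_of_ncard_eq (p q t : ℕ) (hE : M.E.ncard = p + q) (hqt : q < t) (htp : t < p)
    (𝒜 : Set (Set α)) (h𝒜 : 𝒜 ⊆ cellMembers M p q) :
    ((p + q).choose t : ℚ) * (𝒜.ncard : ℚ) ≤
      ((p + q).choose q : ℚ) * ({S ∈ downNbhd M p q 𝒜 | M.eRk S = (t : ℕ∞)}.ncard : ℚ) := by
  classical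
  have h𝒜' : ∀ Z ∈ 𝒜, Z ⊆ M.E ∧ M.eRk Z = (q : ℕ∞) ∧ M.eRk (M.E \ Z) = (p : ℕ∞) := fun Z hZ => h𝒜 hZ
  have hEfin : M.E.Finite := M.ground_finite
  set Ef : Finset α := hEfin.toFinset with hEf
  have hEcard : Ef.card = M.E.ncard := (ncard_eq_toFinset_card _ hEfin).symm
  have h𝒜fin : 𝒜.Finite := hEfin.finite_subsets.subset (fun Z hZ => (h𝒜' Z hZ).1)
  have hcoe : ∀ Z : Set α, ((Ef.filter (fun x => x ∉ Z) : Finset α) : Set α) = M.E \ Z := by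
    intro Z
    ext x
    simp [Finset.coe_filter, hEf, hEfin.mem_toFinset]
  set ℬ : Finset (Finset α) := h𝒜fin.toFinset.image (fun Z => Ef.filter (fun x => x ∉ Z)) with hℬdef
  have hℬcard : ℬ.card = 𝒜.ncard := by
    rw [hℬdef, Finset.card_image_of_injOn, ncard_eq_toFinset_card _ h𝒜fin]
    intro Z₁ hZ₁ Z₂ hZ₂ hEq
    rw [Finset.mem_coe, h𝒜fin.mem_toFinset] at hZ₁ hZ₂
    have hc : ((Ef.filter (fun x => x ∉ Z₁) : Finset α) : Set α) =
        ((Ef.filter (fun x => x ∉ Z₂) : Finset α) : Set α) := by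
      simp only at hEq
      rw [hEq]
    rw [hcoe, hcoe] at hc
    have h1 := (h𝒜' Z₁ hZ₁).1
    have h2 := (h𝒜' Z₂ hZ₂).1
    calc Z₁ = M.E \ (M.E \ Z₁) := (Set.sdiff_sdiff_cancel_left h1).symm
      _ = M.E \ (M.E \ Z₂) := by rw [hc]
      _ = Z₂ := Set.sdiff_sdiff_cancel_left h2
  have hℬ : ∀ B ∈ ℬ, B ⊆ Ef ∧ B.card = p := by
    intro B hB
    rw [hℬdef, Finset.mem_image] at hB
    obtain ⟨Z, hZ, rfl⟩ := hB
    rw [h𝒜fin.mem_toFinset] at hZ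
    obtain ⟨-, hAcard⟩ := compl_indep_of_mem_U M hE (h𝒜' Z hZ)
    refine ⟨Finset.filter_subset _ _, ?_⟩
    rw [← ncard_coe_finset, hcoe, hAcard]
  -- the level-t shadow injects into the rank-t DOWN-neighbours
  set F : Finset (Finset α) := ℬ.biUnion (fun B => B.powersetCard t) with hF
  set T : Set (Set α) := {S ∈ downNbhd M p q 𝒜 | M.eRk S = (t : ℕ∞)} with hT
  have hTfin : T.Finite := hEfin.finite_subsets.subset (fun S hS => hS.1.1)
  have hFT : ((F : Set (Finset α))).ncard ≤ T.ncard := by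
    refine ncard_le_ncard_of_injOn (fun s => (s : Set α)) ?_ ?_ hTfin
    · intro s hs
      rw [Finset.mem_coe, hF, Finset.mem_biUnion] at hs
      obtain ⟨B, hB, hs⟩ := hs
      rw [Finset.mem_powersetCard] at hs
      obtain ⟨hsB, hscard⟩ := hs
      have hB' := hB
      rw [hℬdef, Finset.mem_image] at hB'
      obtain ⟨Z, hZ, rfl⟩ := hB'
      rw [h𝒜fin.mem_toFinset] at hZ
      obtain ⟨hind, -⟩ := compl_indep_of_mem_U M hE (h𝒜' Z hZ)
      have hsub : (s : Set α) ⊆ M.E \ Z := by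
        rw [← hcoe Z]
        exact_mod_cast hsB
      have hsind : M.Indep (s : Set α) := hind.subset hsub
      have hrk : M.eRk (s : Set α) = (t : ℕ∞) := by
        rw [hsind.eRk_eq_encard, encard_coe_eq_coe_finsetCard, hscard]
      refine ⟨⟨hsub.trans sdiff_subset, ?_, ?_, Z, hZ, hsub⟩, hrk⟩
      · rw [hrk]; exact_mod_cast hqt
      · rw [hrk]; exact_mod_cast htp
    · intro s _ s' _ hEq
      exact Finset.coe_injective hEq
  rw [ncard_coe_finset] at hFT
  have hbin := choose_mul_card_le_choose_mul_card_shadow Ef ℬ p t (by omega) hℬ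
  rw [hEcard, hE] at hbin
  have hsym : (p + q).choose p = (p + q).choose q := Nat.choose_symm_add
  rw [hsym] at hbin
  have hbin' : ((p + q).choose t : ℚ) * (ℬ.card : ℚ) ≤ ((p + q).choose q : ℚ) * (F.card : ℚ) := by
    exact_mod_cast hbin
  rw [← hℬcard]
  calc ((p + q).choose t : ℚ) * (ℬ.card : ℚ)
      ≤ ((p + q).choose q : ℚ) * (F.card : ℚ) := hbin'
    _ ≤ ((p + q).choose q : ℚ) * (T.ncard : ℚ) := by
        apply mul_le_mul_of_nonneg_left _ (by positivity)
        exact_mod_cast hFT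

/-- **C-044 DOWN at the tight layer, recovered from its levels** (the sum over `q < t < p`): the level theorem implies
night-1 g12's `hallDown_of_ncard_eq` — recorded as a cross-check of the level decomposition. -/
theorem hallDown_of_levels (p q : ℕ) (hE : M.E.ncard = p + q) (𝒜 : Set (Set α))
    (h𝒜 : 𝒜 ⊆ cellMembers M p q) :
    phiK p q * (𝒜.ncard : ℚ) ≤ ((downNbhd M p q 𝒜).ncard : ℚ) := by
  classical
  have hsplit := ncard_eq_sum_ncard_level (M := M) p q (downNbhd M p q 𝒜)
    (downNbhd_subset_cellY (M := M) 𝒜 p q)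
  have hchoose : (0 : ℚ) < ((p + q).choose p : ℚ) := by
    exact_mod_cast Nat.choose_pos (by omega)
  have hsym : ((p + q).choose q : ℚ) = ((p + q).choose p : ℚ) := by
    exact_mod_cast (Nat.choose_symm_add (a := p) (b := q)).symm
  rw [hsplit]
  unfold phiK
  rw [div_mul_eq_mul_div, div_le_iff₀ hchoose, Finset.sum_mul, Finset.sum_mul]
  refine Finset.sum_le_sum (fun t ht => ?_)
  rw [Finset.mem_Ioo] at ht
  have := hallDown_level_of_ncard_eq (M := M) p q t hE ht.1 ht.2 𝒜 h𝒜
  rw [hsym] at this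
  linarith

end PercRepro
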